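import Summits.Parity.GeneralizedHardyLittlewood.Theorems.GreenTaoLevelTwoGITwoCyclicInverseBohrAveraging
import Summits.Parity.GeneralizedHardyLittlewood.Theorems.GreenTaoLevelTwoGITwoCyclicInverseBohrRegularPrelims
import Summits.Parity.GeneralizedHardyLittlewood.Theorems.GreenTaoLevelTwoGITwoCyclicInverseLocalLinear
import Summits.Parity.GeneralizedHardyLittlewood.Theorems.GreenTaoLevelTwoGITwoCyclicInverseGeomSum
import Mathlib.Analysis.SpecialFunctions.Complex.Circle

/-!
# Route `GreenTaoLevelTwo`, crux `GITwo` (stmt-Parity-21275), line `birth`, stub `stub_cyclicInverse`: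
# generalized Fourier decay on a regular Bohr set (GT08a arXiv Lemma 38)

Twenty-seventh helper file toward the XL stub `stub_cyclicInverse` (B. Green, T. Tao, *An inverse
theorem for the Gowers `U³(G)` norm*, arXiv:math/0503014, Thm. 68 = PEMS 51 (2008) Thm. 12.8).
Block B7 of the printed proof (local Fourier analysis on regular Bohr sets), arXiv Lemma 38: if
`B = B(S,ρ)` (`d = #S ≥ 1`) is regular, `φ : ℤ/Nℤ → ℝ/ℤ` is locally linear on `B`
(`φ(x+y) = φ(x) + φ(y)` for `x, y ∈ B`) and has a large generalized Fourier coefficient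
`|Σ_{x∈B} e(φ(x))| ≥ η #B` (`0 < η ≤ 1`), then `φ` is nearly constant near the origin:
`‖φ(y)‖_{ℝ/ℤ} ≤ 2¹² d ‖y‖_S /(ρ η²)` for every `y ∈ B`, `‖y‖_S = sup_{ξ∈S} ‖ξy‖` (here: any
`t > 0` with `‖ξ y‖ ≤ t` for all `ξ ∈ S`).  Assembled from the landed bricks: averaging on a regular
Bohr set (arXiv Lemma 21 (i), `norm_sum_shift_sub_sum_le_of_regular`), iteration of local
additivity (`map_add_nsmul_of_locAdd`) and the geometric-series bound
(`norm_sum_range_exp_mul_le`); the shifts are `n•y`, `0 ≤ n ≤ M = ⌊ηρ/(400 d t)⌋` (one-sided,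
which only improves the paper's constants), regularity is used at `κ = ±M t/ρ`.  The character
`e : ℝ/ℤ → ℂ` is Mathlib's `AddCircle.toCircle`.

* `coe_toCircle_nsmul_coe` — `e(n•θ) = exp(2πi nθ)` for a real lift `θ`;
* `norm_toAddCircle_nsmul_mul_le` — `‖(n•y)ξ‖_{ℝ/ℤ} ≤ n ‖yξ‖_{ℝ/ℤ}`;
* `norm_phase_le_of_locAdd` — **arXiv Lemma 38** as displayed above (regularity of `B(S,ρ)` is
  the def-free Def. 16 statement produced by `exists_regular_bohr`; `S` nonempty — for `S = ∅`
  add the frequency `0`, which does not change the Bohr set).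

References: [GreenTao2008U3Inverse] arXiv:math/0503014, Lemma 38 and Def. 16.
-/

noncomputable section

namespace Summit.Parity.GeneralizedHardyLittlewood.GreenTaoLevelTwoGITwoCyclicInverse

open Finset

variable {N : ℕ} [NeZero N]

omit [NeZero N] in
/-- `e(n•θ) = exp(2πi nθ)` for the character `e = AddCircle.toCircle` of `ℝ/ℤ` and a real lift
`θ`. [folklore] -/
theorem coe_toCircle_nsmul_coe (θ : ℝ) (n : ℕ) :
    ((AddCircle.toCircle (n • ((θ : ℝ) : UnitAddCircle)) : Circle) : ℂ) =
      Complex.exp (2 * Real.pi * Complex.I * (n * θ)) := by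
  rw [← AddCircle.coe_nsmul, AddCircle.toCircle_apply_mk, Circle.coe_exp, nsmul_eq_mul]
  congr 1
  push_cast
  ring

/-- `‖(n•y)ξ‖_{ℝ/ℤ} ≤ n ‖yξ‖_{ℝ/ℤ}`. [folklore] -/
theorem norm_toAddCircle_nsmul_mul_le (y ξ : ZMod N) (n : ℕ) :
    ‖ZMod.toAddCircle ((n • y) * ξ)‖ ≤ n * ‖ZMod.toAddCircle (y * ξ)‖ := by
  rw [smul_mul_assoc, map_nsmul]
  exact norm_nsmul_le

/-- **Generalized Fourier decay (GT08a arXiv Lemma 38).**  Let `S ⊆ ℤ/Nℤ` be nonempty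
(`d = #S`), `ρ > 0`, and suppose `B = B(S,ρ) = {x : ‖toAddCircle(xξ)‖ < ρ ∀ ξ ∈ S}` is regular
(arXiv Def. 16).  Let `φ : ℤ/Nℤ → ℝ/ℤ` be locally linear on `B` and `|Σ_{x∈B} e(φ(x))| ≥ η #B` with
`0 < η ≤ 1`.  Then for every `y ∈ B` and every `t > 0` with `‖toAddCircle(yξ)‖ ≤ t` for all
`ξ ∈ S`: `‖φ(y)‖_{ℝ/ℤ} ≤ 2¹² d t/(ρ η²)`. [cite: GreenTao2008U3Inverse, Lemma 38] -/
theorem norm_phase_le_of_locAdd (S : Finset (ZMod N)) (hS : S.Nonempty) {ρ η : ℝ} (hρ : 0 < ρ)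
    (hη : 0 < η) (hη1 : η ≤ 1)
    (hreg : ∀ κ : ℝ, |κ| ≤ 1 / (100 * (#S : ℝ)) →
      (1 - 100 * (#S : ℝ) * |κ|) * #{x : ZMod N | ∀ ξ ∈ S, ‖ZMod.toAddCircle (x * ξ)‖ < ρ} ≤
          #{x : ZMod N | ∀ ξ ∈ S, ‖ZMod.toAddCircle (x * ξ)‖ < (1 + κ) * ρ} ∧
        (#{x : ZMod N | ∀ ξ ∈ S, ‖ZMod.toAddCircle (x * ξ)‖ < (1 + κ) * ρ} : ℝ) ≤
          (1 + 100 * (#S : ℝ) * |κ|) * #{x : ZMod N | ∀ ξ ∈ S, ‖ZMod.toAddCircle (x * ξ)‖ < ρ})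
    {φ : ZMod N → UnitAddCircle}
    (hloc : ∀ x ∈ ({x : ZMod N | ∀ ξ ∈ S, ‖ZMod.toAddCircle (x * ξ)‖ < ρ} : Finset (ZMod N)),
      ∀ y ∈ ({x : ZMod N | ∀ ξ ∈ S, ‖ZMod.toAddCircle (x * ξ)‖ < ρ} : Finset (ZMod N)),
        φ (x + y) = φ x + φ y)
    (hbias : η * #{x : ZMod N | ∀ ξ ∈ S, ‖ZMod.toAddCircle (x * ξ)‖ < ρ} ≤
      ‖∑ x ∈ ({x : ZMod N | ∀ ξ ∈ S, ‖ZMod.toAddCircle (x * ξ)‖ < ρ} : Finset (ZMod N)),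
          ((AddCircle.toCircle (φ x) : Circle) : ℂ)‖)
    {y : ZMod N} {t : ℝ} (ht0 : 0 < t) (ht : ∀ ξ ∈ S, ‖ZMod.toAddCircle (y * ξ)‖ ≤ t) :
    ‖φ y‖ ≤ 2 ^ 12 * (#S : ℝ) * t / (ρ * η ^ 2) := by
  classical
  -- names
  set B : Finset (ZMod N) := {x : ZMod N | ∀ ξ ∈ S, ‖ZMod.toAddCircle (x * ξ)‖ < ρ} with hBdef
  have hB : ∀ x, x ∈ B ↔ ∀ ξ ∈ S, ‖ZMod.toAddCircle (x * ξ)‖ < ρ := fun x => by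
    rw [hBdef, mem_filter]; simp
  obtain ⟨d, hd⟩ : ∃ d : ℕ, d = #S := ⟨_, rfl⟩
  have hd1 : (1 : ℝ) ≤ d := by
    rw [hd]; exact_mod_cast Nat.one_le_iff_ne_zero.mpr (card_pos.mpr hS).ne'
  have hd0 : (0 : ℝ) < d := by linarith
  rw [← hd] at hreg ⊢
  set c : ℝ := (#B : ℝ) with hc
  have hc1 : 1 ≤ c := by
    rw [hc]; exact_mod_cast one_le_card_bohr S hρ
  have hc0 : 0 < c := by linarith
  -- the number of shifts
  set L : ℝ := η * ρ / (400 * d * t) with hL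
  have hL0 : 0 < L := by positivity
  obtain ⟨M, hM⟩ : ∃ M : ℕ, M = ⌊L⌋₊ := ⟨_, rfl⟩
  have hM1 : (M : ℝ) ≤ L := by rw [hM]; exact Nat.floor_le hL0.le
  have hM2 : L < M + 1 := by rw [hM]; exact Nat.lt_floor_add_one L
  have ht0' : t ≠ 0 := ht0.ne'
  have hd0' : (d : ℝ) ≠ 0 := hd0.ne'
  have hρ' : ρ ≠ 0 := hρ.ne'
  have hMt : (M : ℝ) * t ≤ η * ρ / (400 * d) := by
    calc (M : ℝ) * t ≤ η * ρ / (400 * d * t) * t := mul_le_mul_of_nonneg_right hM1 ht0.le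
      _ = η * ρ / (400 * d) := by field_simp
  -- the scale `ε = M t / ρ`
  set ε : ℝ := M * t / ρ with hεdef
  have hε0 : 0 ≤ ε := by positivity
  have hερ : ε * ρ = M * t := by rw [hεdef]; field_simp
  have hεη : ε ≤ η / (400 * d) := by
    rw [hεdef, div_le_div_iff₀ hρ (by positivity)]
    calc (M : ℝ) * t * (400 * d) ≤ η * ρ / (400 * d) * (400 * d) := by
          exact mul_le_mul_of_nonneg_right hMt (by positivity)
      _ = η * ρ := by field_simp
  have hε100 : ε ≤ 1 / (100 * d) := by
    refine hεη.trans ?_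
    rw [div_le_div_iff₀ (by positivity) (by positivity)]
    nlinarith
  have hερlt : ε * ρ < ρ := by
    have : ε < 1 := lt_of_le_of_lt hε100 (by
      rw [div_lt_one (by positivity)]; linarith)
    calc ε * ρ < 1 * ρ := mul_lt_mul_of_pos_right this hρ
      _ = ρ := one_mul ρ
  -- the shifts `n • y`, `n ≤ M`
  have hshift : ∀ n : ℕ, n ≤ M → ∀ ξ ∈ S, ‖ZMod.toAddCircle ((n • y) * ξ)‖ ≤ ε * ρ := by
    intro n hn ξ hξ
    rw [hερ]
    calc ‖ZMod.toAddCircle ((n • y) * ξ)‖ ≤ n * ‖ZMod.toAddCircle (y * ξ)‖ :=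
          norm_toAddCircle_nsmul_mul_le y ξ n
      _ ≤ M * t := mul_le_mul (by exact_mod_cast hn) (ht ξ hξ) (norm_nonneg _) (by positivity)
  have hmem : ∀ j : ℕ, j ≤ M → j • y ∈ B := by
    intro j hj
    rw [hB]
    intro ξ hξ
    exact lt_of_le_of_lt (hshift j hj ξ hξ) hερlt
  -- regularity at `κ = ±ε`
  set Bp : Finset (ZMod N) := {x : ZMod N | ∀ ξ ∈ S, ‖ZMod.toAddCircle (x * ξ)‖ < (1 + ε) * ρ}
    with hBpdef
  set Bm : Finset (ZMod N) := {x : ZMod N | ∀ ξ ∈ S, ‖ZMod.toAddCircle (x * ξ)‖ < (1 - ε) * ρ}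
    with hBmdef
  have hBp : ∀ x, x ∈ Bp ↔ ∀ ξ ∈ S, ‖ZMod.toAddCircle (x * ξ)‖ < (1 + ε) * ρ := fun x => by
    rw [hBpdef, mem_filter]; simp
  have hBm : ∀ x, x ∈ Bm ↔ ∀ ξ ∈ S, ‖ZMod.toAddCircle (x * ξ)‖ < (1 - ε) * ρ := fun x => by
    rw [hBmdef, mem_filter]; simp
  have hregp : (#Bp : ℝ) ≤ (1 + 100 * d * ε) * #B := by
    have h := (hreg ε (by rw [abs_of_nonneg hε0]; exact hε100)).2
    rw [abs_of_nonneg hε0] at h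
    exact h
  have hregm : (1 - 100 * d * ε) * #B ≤ (#Bm : ℝ) := by
    have h := (hreg (-ε) (by rw [abs_neg, abs_of_nonneg hε0]; exact hε100)).1
    rw [abs_neg, abs_of_nonneg hε0, ← sub_eq_add_neg] at h
    exact h
  -- the phases
  set f : ZMod N → ℂ := fun x => ((AddCircle.toCircle (φ x) : Circle) : ℂ) with hfdef
  have hf : ∀ x, ‖f x‖ ≤ 1 := fun x => by rw [hfdef]; exact (Circle.norm_coe _).le
  set T : ℂ := ∑ x ∈ B, f x with hTdef
  have hTle : ‖T‖ ≤ c := by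
    rw [hTdef, hc]
    calc ‖∑ x ∈ B, f x‖ ≤ ∑ x ∈ B, ‖f x‖ := norm_sum_le _ _
      _ ≤ ∑ x ∈ B, (1 : ℝ) := sum_le_sum fun x _ => hf x
      _ = #B := by simp
  have hTge : η * c ≤ ‖T‖ := hbias
  set E : ℕ → ℂ := fun n => ((AddCircle.toCircle (n • φ y) : Circle) : ℂ) with hEdef
  -- arXiv Lemma 21 (i) for each shift, combined with local linearity
  have hstep : ∀ n : ℕ, n ≤ M → ‖T * E n - T‖ ≤ 200 * d * ε * c := by
    intro n hn
    have h1 := norm_sum_shift_sub_sum_le_of_regular hB hBp hBm (hshift n hn) hS hregp hregm hf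
    have h2 : ∑ x ∈ B, f (x + n • y) = T * E n := by
      rw [hTdef, sum_mul]
      refine sum_congr rfl fun x hx => ?_
      rw [hfdef, hEdef]
      simp only
      rw [map_add_nsmul_of_locAdd hloc hx hmem hn, AddCircle.toCircle_add, Circle.coe_mul]
    rw [h2] at h1
    exact h1
  -- summing over `0 ≤ n ≤ M`
  set G : ℂ := ∑ n ∈ range (M + 1), E n with hGdef
  have hsum : ‖T * G - (M + 1 : ℕ) * T‖ ≤ (M + 1 : ℕ) * (200 * d * ε * c) := by
    have hrw : T * G - (M + 1 : ℕ) * T = ∑ n ∈ range (M + 1), (T * E n - T) := by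
      rw [hGdef, mul_sum, sum_sub_distrib, sum_const, card_range, nsmul_eq_mul]
    rw [hrw]
    calc ‖∑ n ∈ range (M + 1), (T * E n - T)‖ ≤ ∑ n ∈ range (M + 1), ‖T * E n - T‖ :=
          norm_sum_le _ _
      _ ≤ ∑ n ∈ range (M + 1), 200 * d * ε * c :=
          sum_le_sum fun n hn => hstep n (Nat.lt_succ_iff.mp (mem_range.mp hn))
      _ = (M + 1 : ℕ) * (200 * d * ε * c) := by rw [sum_const, card_range, nsmul_eq_mul]
  -- hence `‖G‖ ≥ (M+1) η / 2`
  have hG : ((M : ℝ) + 1) * η / 2 ≤ ‖G‖ := by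
    have h1 : ((M + 1 : ℕ) : ℝ) * ‖T‖ - ‖T‖ * ‖G‖ ≤ (M + 1 : ℕ) * (200 * d * ε * c) := by
      have h2 : ‖((M + 1 : ℕ) : ℂ) * T‖ - ‖T * G‖ ≤ ‖T * G - (M + 1 : ℕ) * T‖ := by
        rw [← norm_neg (T * G - _), neg_sub]; exact norm_sub_norm_le _ _
      rw [norm_mul, norm_mul, Complex.norm_natCast] at h2
      linarith
    push_cast at h1
    have h200 : 200 * d * ε ≤ η / 2 := by
      have := mul_le_mul_of_nonneg_left hεη (by positivity : (0 : ℝ) ≤ 200 * d)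
      calc 200 * d * ε ≤ 200 * d * (η / (400 * d)) := this
        _ = η / 2 := by field_simp; ring
    -- `(M+1)(η c − η c/2) ≤ ‖T‖ ‖G‖ ≤ c ‖G‖`
    have h3 : ((M : ℝ) + 1) * (η * c) - ((M : ℝ) + 1) * (η / 2 * c) ≤ ‖T‖ * ‖G‖ := by
      have h4 : ((M : ℝ) + 1) * (200 * d * ε * c) ≤ ((M : ℝ) + 1) * (η / 2 * c) := by
        apply mul_le_mul_of_nonneg_left _ (by positivity)
        exact mul_le_mul_of_nonneg_right h200 hc0.le
      have h5 : ((M : ℝ) + 1) * (η * c) ≤ ((M : ℝ) + 1) * ‖T‖ :=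
        mul_le_mul_of_nonneg_left hTge (by positivity)
      linarith
    have h6 : ‖T‖ * ‖G‖ ≤ c * ‖G‖ := mul_le_mul_of_nonneg_right hTle (norm_nonneg _)
    have h7 : ((M : ℝ) + 1) * η / 2 * c ≤ c * ‖G‖ := by linarith
    nlinarith
  -- the geometric-series bound for `G`
  obtain ⟨θ, hθ⟩ : ∃ θ : ℝ, ((θ : ℝ) : UnitAddCircle) = φ y := QuotientAddGroup.mk_surjective (φ y)
  have hGeq : G = ∑ n ∈ range (M + 1), Complex.exp (2 * Real.pi * Complex.I * (n * θ)) := by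
    rw [hGdef]
    refine sum_congr rfl fun n _ => ?_
    rw [hEdef]
    simp only
    rw [← hθ, coe_toCircle_nsmul_coe]
  have hgeom := norm_sum_range_exp_mul_le θ (M + 1)
  rw [← hGeq, hθ] at hgeom
  -- `(M+1) η ‖φ y‖ ≤ 1`
  have hkey : ((M : ℝ) + 1) * η * ‖φ y‖ ≤ 1 := by
    have := mul_le_mul_of_nonneg_right hG (by positivity : (0 : ℝ) ≤ 2 * ‖φ y‖)
    linarith
  -- `η ρ < 400 d t (M + 1)` from the maximality of `M`
  have hmax : η * ρ < 400 * d * t * ((M : ℝ) + 1) := by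
    have := hM2
    rw [hL, div_lt_iff₀ (by positivity)] at this
    linarith
  rw [le_div_iff₀ (by positivity)]
  have hn0 : 0 ≤ ‖φ y‖ := norm_nonneg _
  nlinarith [mul_le_mul_of_nonneg_left hkey (by positivity : (0 : ℝ) ≤ 400 * d * t),
    mul_le_mul_of_nonneg_right hmax.le (mul_nonneg hη.le hn0)]

end Summit.Parity.GeneralizedHardyLittlewood.GreenTaoLevelTwoGITwoCyclicInverse
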